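import Mathlib.Analysis.Calculus.LineDeriv.IntegrationByParts
import Mathlib.Analysis.Distribution.AEEqOfIntegralContDiff
import Mathlib.Analysis.ODE.Gronwall
import Mathlib.Analysis.SpecialFunctions.ExpDeriv
import Mathlib.Analysis.Calculus.Deriv.MeanValue
import Mathlib.MeasureTheory.Measure.OpenPos
import HarnessLib

/-!
# Rellich's lemma, I: the radial ordinary differential equations

Analysis/PDE proof file (theorems only) on the discharge path of the named fact
`Literature.Analysis.PDE.Rellich1943_helmholtz_farField_uniqueness` (`RellichLemma.lean`;
Colton–Kress 1998, Lemma 2.11). In the printed proof the spherical-harmonic coefficients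
`a_n^m(r)` of a solution of `Δu + k²u = 0` solve the spherical Bessel equation
`a'' + (2/r) a' + (k² - n(n+1)/r²) a = 0`, i.e. `w = r a` solves

  `w'' = (n(n+1)/r² - k²) w`,                                                    (⋆)

and the conclusion `a_n^m = 0` is read off from the explicit solutions `h_n^{(1,2)}(kr)` and
their asymptotics (Colton–Kress (2.41), (2.47)). Mathlib has no Bessel functions; this file
replaces that step by two elementary energy arguments for (⋆), valid for any `C²` solution on an
interval, and records the one-variable calculus used to pass from weak to classical radial
equations:

* `eqOn_of_integral_mul_eq` — du Bois-Reymond's lemma on an open set `U ⊆ ℝ`: if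
  `∫ φ B = -∫ φ' A` for all `φ ∈ C_c^∞(U)` then `A' = B` on `U` (integration by parts on the
  line, Mathlib `integral_mul_fderiv_eq_neg_fderiv_mul_of_integrable`, and the fundamental lemma
  of the calculus of variations, `IsOpen.ae_eq_zero_of_integral_contDiff_smul_eq_zero`);
* `ode_eq_zero_of_eventually_eq_zero` — a `C²` solution of `w'' = q w` (`q` bounded) on an
  interval which vanishes near one point vanishes identically to the right of it (Grönwall for
  the energy `w'² + w²`);
* `ode_eq_zero_of_tendsto_zero` — **the substitute for the Hankel asymptotics**: a `C²`
  solution of (⋆) on `(a, ∞)`, `a > 0`, `k > 0`, `c = n(n+1) ≥ 0`, with `w(r) → 0` as `r → ∞`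
  vanishes identically. Proof: the energy `E = w'² + k²w²` has `E' = 2(c/r²) w w'`,
  `|E'| ≤ (c/(k r²)) E`, so `E e^{-c/(kr)}` increases and `E e^{c/(kr)}` decreases; hence if
  `E(r₀) > 0` then `0 < m ≤ E ≤ M` on `[r₀, ∞)`. But `(w w')' = w'² + (c/r² - k²) w² ≥ E - 2k²w²
  ≥ m/2` eventually (as `w → 0`), forcing `w w' → +∞`, while `|w w'| ≤ √M |w| → 0`.

## References

* D. Colton, R. Kress, *Inverse Acoustic and Electromagnetic Scattering Theory*, 2nd ed.,
  Springer 1998, Lemma 2.11 and (2.36)–(2.41), (2.47). [ColtonKress1998]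
* F. Rellich, Jber. Deutsch. Math.-Verein. 53 (1943) 57–65. [Rellich1943]
-/

noncomputable section

open MeasureTheory Set Filter Topology
open scoped ContDiff

namespace Literature.Analysis.PDE

namespace Rellich

/-! ### Du Bois-Reymond's lemma on an open set of the line -/

/-- A product `φ · A` with `φ` continuous and supported inside an open set `U` on which `A` is
continuous is continuous everywhere. [folklore] -/
theorem continuous_mul_of_tsupport_subset {φ A : ℝ → ℝ} {U : Set ℝ} (hU : IsOpen U)
    (hφ : Continuous φ) (hsupp : tsupport φ ⊆ U) (hA : ContinuousOn A U) :
    Continuous fun r => φ r * A r := by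
  refine continuous_iff_continuousAt.2 fun r => ?_
  by_cases hr : r ∈ U
  · exact hφ.continuousAt.mul (hA.continuousAt (hU.mem_nhds hr))
  · have h0 : φ =ᶠ[𝓝 r] 0 := notMem_tsupport_iff_eventuallyEq.1 fun h => hr (hsupp h)
    have h1 : (fun r => φ r * A r) =ᶠ[𝓝 r] fun _ => 0 := by
      filter_upwards [h0] with s hs
      simp [hs]
    exact (continuousAt_const.congr_of_eventuallyEq h1 :)

/-- **Du Bois-Reymond's lemma on an open set.** Let `U ⊆ ℝ` be open, `A ∈ C¹(ℝ)` with
derivative `A'`, and `B` continuous. If `∫ φ B = -∫ φ' A` for every smooth `φ` with compact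
support inside `U`, then `A' = B` on `U` (integrate by parts, then apply the fundamental lemma of
the calculus of variations and continuity). [folklore] -/
theorem eqOn_of_integral_mul_eq {U : Set ℝ} (hU : IsOpen U) {A A' B : ℝ → ℝ}
    (hA : ∀ r, HasDerivAt A (A' r) r) (hA' : Continuous A') (hB : Continuous B)
    (h : ∀ φ : ℝ → ℝ, ContDiff ℝ ∞ φ → HasCompactSupport φ → tsupport φ ⊆ U →
      ∫ r, φ r * B r = -∫ r, deriv φ r * A r) :
    EqOn A' B U := by
  have hAc : Continuous A := continuous_iff_continuousAt.2 fun r => (hA r).continuousAt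
  have hdA : (fun r => fderiv ℝ A r 1) = A' := funext fun r => by
    rw [fderiv_apply_one_eq_deriv, (hA r).deriv]
  -- integration by parts on the line: `∫ φ' A = -∫ φ A'`
  have hibp : ∀ φ : ℝ → ℝ, ContDiff ℝ ∞ φ → HasCompactSupport φ →
      ∫ r, deriv φ r * A r = -∫ r, φ r * A' r := by
    intro φ hφ hφc
    have hφd : Differentiable ℝ φ := hφ.differentiable (by simp)
    have hdφc : HasCompactSupport (deriv φ) := hφc.deriv
    have e := integral_mul_fderiv_eq_neg_fderiv_mul_of_integrable (μ := (volume : Measure ℝ))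
      (f := A) (g := φ) (v := 1) ?_ ?_ ?_ (fun r _ => (hA r).differentiableAt)
      (fun r _ => hφd r)
    · have e1 : ∫ r, A r * fderiv ℝ φ r 1 = ∫ r, deriv φ r * A r :=
        integral_congr_ae (ae_of_all _ fun r => by
          dsimp only
          rw [fderiv_apply_one_eq_deriv, mul_comm])
      have e2 : ∫ r, fderiv ℝ A r 1 * φ r = ∫ r, φ r * A' r :=
        integral_congr_ae (ae_of_all _ fun r => by
          dsimp only
          rw [fderiv_apply_one_eq_deriv, (hA r).deriv, mul_comm])
      rw [← e1, e, e2]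
    · have : (fun x => fderiv ℝ A x 1 * φ x) = fun x => A' x * φ x := funext fun x => by
        rw [fderiv_apply_one_eq_deriv, (hA x).deriv]
      rw [this]
      exact ((hA'.mul hφ.continuous).integrable_of_hasCompactSupport (hφc.mul_left))
    · have : (fun r => A r * fderiv ℝ φ r 1) = fun r => A r * deriv φ r := funext fun r => by
        rw [fderiv_apply_one_eq_deriv]
      rw [this]
      exact (hAc.mul (hφ.continuous_deriv (by simp))).integrable_of_hasCompactSupport
        hdφc.mul_left
    · exact (hAc.mul hφ.continuous).integrable_of_hasCompactSupport hφc.mul_left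
  -- the fundamental lemma of the calculus of variations on `U`
  have hloc : LocallyIntegrableOn (fun r => B r - A' r) U volume :=
    (hB.sub hA').locallyIntegrable.locallyIntegrableOn U
  have hae := hU.ae_eq_zero_of_integral_contDiff_smul_eq_zero hloc fun φ hφ hφc hφs => by
    have hi1 : Integrable (fun r => φ r * B r) (volume : Measure ℝ) :=
      (hφ.continuous.mul hB).integrable_of_hasCompactSupport hφc.mul_right
    have hi2 : Integrable (fun r => φ r * A' r) (volume : Measure ℝ) :=
      (hφ.continuous.mul hA').integrable_of_hasCompactSupport hφc.mul_right
    simp only [smul_eq_mul, mul_sub]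
    rw [integral_sub hi1 hi2, h φ hφ hφc hφs, hibp φ hφ hφc]
    ring
  have hae' : (fun r => B r - A' r) =ᵐ[volume.restrict U] fun _ => (0 : ℝ) :=
    (ae_restrict_iff' hU.measurableSet).2 hae
  have heq := Measure.eqOn_open_of_ae_eq hae' hU (hB.sub hA').continuousOn continuousOn_const
  intro r hr
  have := heq hr
  simp only at this
  linarith

/-! ### Uniqueness for `w'' = q w` from vanishing near a point -/

/-- **Forward uniqueness for a linear second-order equation.** Let `w` be twice differentiable
on `[c, b)` with `w'' = q w` there, `|q| ≤ L`, and `w(c) = w'(c) = 0`. Then `w = 0` on `[c, b)`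
(Grönwall's inequality for the energy `w'² + w²`, whose derivative `2(q + 1) w w'` is bounded by
`(L + 1)(w'² + w²)`). [folklore] -/
theorem ode_eq_zero_of_eq_zero {w w' w'' q : ℝ → ℝ} {b c L : ℝ}
    (hw : ∀ r ∈ Ico c b, HasDerivAt w (w' r) r) (hw' : ∀ r ∈ Ico c b, HasDerivAt w' (w'' r) r)
    (hode : ∀ r ∈ Ico c b, w'' r = q r * w r) (hq : ∀ r ∈ Ico c b, |q r| ≤ L)
    (h0 : w c = 0) (h0' : w' c = 0) : ∀ r ∈ Ico c b, w r = 0 := by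
  intro r hr
  -- work on the compact interval `[c, R]`, `R = r`
  set F : ℝ → ℝ := fun s => w' s ^ 2 + w s ^ 2 with hF
  set F' : ℝ → ℝ := fun s => 2 * (q s + 1) * w s * w' s with hF'
  have hFd : ∀ s ∈ Ico c b, HasDerivAt F (F' s) s := fun s hs => by
    have h1 := (hw' s hs).pow 2
    have h2 := (hw s hs).pow 2
    refine (h1.add h2).congr_deriv ?_
    simp only [hF', Nat.cast_ofNat, hode s hs]
    ring
  have hL : 0 ≤ L := (abs_nonneg _).trans (hq c ⟨le_rfl, hr.2.trans_le' hr.1 |>.trans_le' le_rfl⟩)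
  have hIcc : Icc c r ⊆ Ico c b := fun s hs => ⟨hs.1, hs.2.trans_lt hr.2⟩
  have hcont : ContinuousOn F (Icc c r) := fun s hs =>
    (hFd s (hIcc hs)).continuousAt.continuousWithinAt
  have hderiv : ∀ s ∈ Ico c r, HasDerivWithinAt F (F' s) (Ici s) s := fun s hs =>
    (hFd s ⟨hs.1, hs.2.trans hr.2⟩).hasDerivWithinAt
  have hFc : ‖F c‖ ≤ 0 := by simp [hF, h0, h0']
  have hbound : ∀ s ∈ Ico c r, ‖F' s‖ ≤ (L + 1) * ‖F s‖ + 0 := fun s hs => by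
    have hs' : s ∈ Ico c b := ⟨hs.1, hs.2.trans hr.2⟩
    have hqs := hq s hs'
    have hFs : 0 ≤ F s := by positivity
    rw [add_zero, Real.norm_eq_abs, Real.norm_eq_abs, abs_of_nonneg hFs, hF']
    have h2 : 2 * |w s| * |w' s| ≤ w' s ^ 2 + w s ^ 2 := by
      nlinarith [sq_nonneg (|w s| - |w' s|), sq_abs (w s), sq_abs (w' s)]
    calc |2 * (q s + 1) * w s * w' s| = |q s + 1| * (2 * |w s| * |w' s|) := by
          rw [abs_mul, abs_mul, abs_mul, abs_two]; ring
      _ ≤ (L + 1) * (w' s ^ 2 + w s ^ 2) := by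
          refine mul_le_mul ((abs_add_le _ _).trans (by rw [abs_one]; linarith)) h2
            (by positivity) (by linarith)
  have hG := norm_le_gronwallBound_of_norm_deriv_right_le hcont hderiv hFc hbound r
    ⟨hr.1, le_rfl⟩
  rw [gronwallBound_ε0_δ0] at hG
  have hF0 : F r = 0 := by
    have : ‖F r‖ = 0 := le_antisymm hG (norm_nonneg _)
    exact norm_eq_zero.1 this
  have : w r ^ 2 = 0 := by
    have h1 : 0 ≤ w' r ^ 2 := sq_nonneg _
    have h2 : 0 ≤ w r ^ 2 := sq_nonneg _
    simp only [hF] at hF0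
    linarith
  exact pow_eq_zero_iff two_ne_zero |>.1 this

/-- **A solution of `w'' = q w` vanishing on a subinterval vanishes to the right.** If `w` is
twice differentiable with `w'' = q w` on `(a, b)`, `|q| ≤ L` there, and `w = 0` on `(a, a')`
for some `a < a'`, then `w = 0` on `(a, b)`. [folklore] -/
theorem ode_eq_zero_of_eqOn_zero {w w' w'' q : ℝ → ℝ} {a a' b L : ℝ} (haa' : a < a')
    (hw : ∀ r ∈ Ioo a b, HasDerivAt w (w' r) r) (hw' : ∀ r ∈ Ioo a b, HasDerivAt w' (w'' r) r)
    (hode : ∀ r ∈ Ioo a b, w'' r = q r * w r) (hq : ∀ r ∈ Ioo a b, |q r| ≤ L)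
    (h0 : ∀ r ∈ Ioo a a', w r = 0) : ∀ r ∈ Ioo a b, w r = 0 := by
  intro r hr
  by_cases hra : r < a'
  · exact h0 r ⟨hr.1, hra⟩
  push Not at hra
  -- a point `c ∈ (a, a')` to the left of `r`, where `w` vanishes identically nearby
  obtain ⟨c, hac, hca'⟩ : ∃ c, a < c ∧ c < a' := exists_between haa'
  have hcb : c < b := hca'.trans_le (hra.trans hr.2.le)
  have hwc : w =ᶠ[𝓝 c] fun _ => 0 := by
    filter_upwards [Ioo_mem_nhds hac hca'] with s hs using h0 s hs
  have h0c : w c = 0 := h0 c ⟨hac, hca'⟩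
  have h0c' : w' c = 0 := by
    have h1 : HasDerivAt w 0 c := (hasDerivAt_const c (0 : ℝ)).congr_of_eventuallyEq hwc
    exact (hw c ⟨hac, hcb⟩).unique h1
  have hsub : Ico c b ⊆ Ioo a b := fun s hs => ⟨hac.trans_le hs.1, hs.2⟩
  exact ode_eq_zero_of_eq_zero (fun s hs => hw s (hsub hs)) (fun s hs => hw' s (hsub hs))
    (fun s hs => hode s (hsub hs)) (fun s hs => hq s (hsub hs)) h0c h0c' r ⟨hca'.le.trans hra, hr.2⟩

/-! ### Decay at infinity forces vanishing: the substitute for the Hankel asymptotics -/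

/-- The elementary inequality `2 k |w| |w'| ≤ w'² + k² w²`. [folklore] -/
theorem two_mul_abs_mul_abs_le (k w w' : ℝ) : 2 * k * |w| * |w'| ≤ w' ^ 2 + k ^ 2 * w ^ 2 := by
  nlinarith [sq_nonneg (k * |w| - |w'|), sq_abs w, sq_abs w']

/-- **Energy bounds for `w'' = (c/r² - k²) w`.** For a twice differentiable solution on
`(a, ∞)` (`a > 0`, `k > 0`, `c ≥ 0`) the energy `E = w'² + k² w²` satisfies, for `a < r₀ ≤ r`,
`E(r₀) e^{-c/(k r₀)} ≤ E(r) ≤ E(r₀) e^{c/(k r₀)}` (the functions `E e^{∓ c/(kr)}` are monotone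
since `|E'| = |2(c/r²) w w'| ≤ (c/(kr²)) E`). [folklore] -/
theorem energy_bounds {w w' w'' : ℝ → ℝ} {a k c : ℝ} (ha : 0 < a) (hk : 0 < k) (hc : 0 ≤ c)
    (hw : ∀ r, a < r → HasDerivAt w (w' r) r) (hw' : ∀ r, a < r → HasDerivAt w' (w'' r) r)
    (hode : ∀ r, a < r → w'' r = (c / r ^ 2 - k ^ 2) * w r) {r₀ r : ℝ} (hr₀ : a < r₀)
    (hr : r₀ ≤ r) :
    (w' r₀ ^ 2 + k ^ 2 * w r₀ ^ 2) * Real.exp (-(c / (k * r₀))) ≤ w' r ^ 2 + k ^ 2 * w r ^ 2 ∧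
      w' r ^ 2 + k ^ 2 * w r ^ 2 ≤ (w' r₀ ^ 2 + k ^ 2 * w r₀ ^ 2) * Real.exp (c / (k * r₀)) := by
  set E : ℝ → ℝ := fun s => w' s ^ 2 + k ^ 2 * w s ^ 2 with hE
  set E' : ℝ → ℝ := fun s => 2 * (c / s ^ 2) * w s * w' s with hE'
  have hEd : ∀ s, a < s → HasDerivAt E (E' s) s := fun s hs => by
    have h1 := (hw' s hs).pow 2
    have h2 := ((hw s hs).pow 2).const_mul (k ^ 2)
    refine (h1.add h2).congr_deriv ?_
    simp only [hE', Nat.cast_ofNat, hode s hs]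
    ring
  have hEnn : ∀ s, 0 ≤ E s := fun s => by positivity
  -- `|E'| ≤ (c/(k s²)) E`
  have hE'le : ∀ s, a < s → |E' s| ≤ c / (k * s ^ 2) * E s := fun s hs => by
    have hs0 : 0 < s := ha.trans hs
    have h2 := two_mul_abs_mul_abs_le k (w s) (w' s)
    have hcs : 0 ≤ c / s ^ 2 := by positivity
    calc |E' s| = c / s ^ 2 * (2 * |w s| * |w' s|) := by
          simp only [hE', abs_mul, abs_two, abs_of_nonneg hcs]; ring
      _ = c / (k * s ^ 2) * (2 * k * |w s| * |w' s|) := by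
          field_simp
      _ ≤ c / (k * s ^ 2) * E s := mul_le_mul_of_nonneg_left h2 (by positivity)
  -- the exponential weights and their derivatives
  have hexp : ∀ (σ : ℝ) (s : ℝ), a < s →
      HasDerivAt (fun s => Real.exp (σ * (c / (k * s)))) (Real.exp (σ * (c / (k * s))) *
        (σ * (-(c / (k * s ^ 2))))) s := fun σ s hs => by
    have hs0 : s ≠ 0 := (ha.trans hs).ne'
    have h1 : HasDerivAt (fun s : ℝ => c / (k * s)) (-(c / (k * s ^ 2))) s := by
      have := ((hasDerivAt_inv hs0).const_mul (c / k))
      refine (this.congr_of_eventuallyEq ?_).congr_deriv ?_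
      · exact Eventually.of_forall fun t => by show c / (k * t) = c / k * t⁻¹; field_simp
      · field_simp
    exact ((h1.const_mul σ).exp)
  -- `Φ = E e^{-c/(ks)}` is monotone, `Ψ = E e^{c/(ks)}` is antitone on `[r₀, ∞)`
  have hmono : MonotoneOn (fun s => E s * Real.exp ((-1) * (c / (k * s)))) (Ici r₀) := by
    refine monotoneOn_of_hasDerivWithinAt_nonneg (convex_Ici r₀)
      (f' := fun s => E' s * Real.exp ((-1) * (c / (k * s))) +
        E s * (Real.exp ((-1) * (c / (k * s))) * ((-1) * (-(c / (k * s ^ 2)))))) ?_ ?_ ?_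
    · intro s hs
      exact (((hEd s (hr₀.trans_le hs)).mul (hexp (-1) s (hr₀.trans_le hs))).continuousAt
        |>.continuousWithinAt)
    · intro s hs
      rw [interior_Ici] at hs
      exact ((hEd s (hr₀.trans hs)).mul (hexp (-1) s (hr₀.trans hs))).hasDerivWithinAt
    · intro s hs
      rw [interior_Ici] at hs
      have hs' : a < s := hr₀.trans hs
      have hpos : 0 < Real.exp ((-1) * (c / (k * s))) := Real.exp_pos _
      have key : -(c / (k * s ^ 2) * E s) ≤ E' s := (abs_le.1 (hE'le s hs')).1
      have : 0 ≤ (E' s + E s * (c / (k * s ^ 2))) * Real.exp ((-1) * (c / (k * s))) :=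
        mul_nonneg (by linarith) hpos.le
      calc (0 : ℝ) ≤ (E' s + E s * (c / (k * s ^ 2))) * Real.exp ((-1) * (c / (k * s))) := this
        _ = _ := by ring
  have hanti : AntitoneOn (fun s => E s * Real.exp (1 * (c / (k * s)))) (Ici r₀) := by
    refine antitoneOn_of_hasDerivWithinAt_nonpos (convex_Ici r₀)
      (f' := fun s => E' s * Real.exp (1 * (c / (k * s))) +
        E s * (Real.exp (1 * (c / (k * s))) * (1 * (-(c / (k * s ^ 2)))))) ?_ ?_ ?_
    · intro s hs
      exact (((hEd s (hr₀.trans_le hs)).mul (hexp 1 s (hr₀.trans_le hs))).continuousAt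
        |>.continuousWithinAt)
    · intro s hs
      rw [interior_Ici] at hs
      exact ((hEd s (hr₀.trans hs)).mul (hexp 1 s (hr₀.trans hs))).hasDerivWithinAt
    · intro s hs
      rw [interior_Ici] at hs
      have hs' : a < s := hr₀.trans hs
      have hpos : 0 < Real.exp (1 * (c / (k * s))) := Real.exp_pos _
      have key : E' s ≤ c / (k * s ^ 2) * E s := (abs_le.1 (hE'le s hs')).2
      have : (E' s - E s * (c / (k * s ^ 2))) * Real.exp (1 * (c / (k * s))) ≤ 0 :=
        mul_nonpos_of_nonpos_of_nonneg (by linarith) hpos.le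
      calc _ = (E' s - E s * (c / (k * s ^ 2))) * Real.exp (1 * (c / (k * s))) := by ring
        _ ≤ 0 := this
  have h1 := hmono (self_mem_Ici (a := r₀)) (mem_Ici.2 hr) hr
  have h2 := hanti (self_mem_Ici (a := r₀)) (mem_Ici.2 hr) hr
  simp only [neg_mul, one_mul] at h1 h2
  have hr0' : 0 < r := (ha.trans hr₀).trans_le hr
  have hckr : 0 ≤ c / (k * r) := by positivity
  constructor
  · -- lower bound: `E r₀ e^{-c/(k r₀)} ≤ E r e^{-c/(kr)} ≤ E r`
    calc E r₀ * Real.exp (-(c / (k * r₀))) ≤ E r * Real.exp (-(c / (k * r))) := h1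
      _ ≤ E r * 1 := by
          refine mul_le_mul_of_nonneg_left ?_ (hEnn r)
          rw [Real.exp_le_one_iff]
          linarith
      _ = E r := mul_one _
  · -- upper bound: `E r ≤ E r e^{c/(kr)} ≤ E r₀ e^{c/(k r₀)}`
    calc E r = E r * 1 := (mul_one _).symm
      _ ≤ E r * Real.exp (c / (k * r)) :=
          mul_le_mul_of_nonneg_left (Real.one_le_exp hckr) (hEnn r)
      _ ≤ E r₀ * Real.exp (c / (k * r₀)) := h2

/-- **Decay at infinity forces vanishing** (the replacement for Colton–Kress's use of the
asymptotics (2.41) of the spherical Hankel functions in the proof of Lemma 2.11). Let `w` be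
twice differentiable on `(a, ∞)`, `a > 0`, with `w'' = (c/r² - k²) w` there (`k > 0`, `c ≥ 0`),
and `w(r) → 0` as `r → ∞`. Then `w = 0` on `(a, ∞)`. See the module docstring for the energy
argument. [cite: ColtonKress1998, Lemma 2.11 (proof) and (2.41)] -/
theorem ode_eq_zero_of_tendsto_zero {w w' w'' : ℝ → ℝ} {a k c : ℝ} (ha : 0 < a) (hk : 0 < k)
    (hc : 0 ≤ c) (hw : ∀ r, a < r → HasDerivAt w (w' r) r)
    (hw' : ∀ r, a < r → HasDerivAt w' (w'' r) r)
    (hode : ∀ r, a < r → w'' r = (c / r ^ 2 - k ^ 2) * w r)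
    (hlim : Tendsto w atTop (𝓝 0)) : ∀ r, a < r → w r = 0 := by
  intro r₀ hr₀
  -- it suffices to show that the energy vanishes at `r₀`
  set E : ℝ → ℝ := fun s => w' s ^ 2 + k ^ 2 * w s ^ 2 with hE
  suffices hE0 : E r₀ = 0 by
    have h1 : 0 ≤ w' r₀ ^ 2 := sq_nonneg _
    have h2 : k ^ 2 * w r₀ ^ 2 = 0 := by
      have : 0 ≤ k ^ 2 * w r₀ ^ 2 := by positivity
      simp only [hE] at hE0
      linarith
    rcases mul_eq_zero.1 h2 with h | h
    · exact absurd (pow_eq_zero_iff two_ne_zero |>.1 h) hk.ne'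
    · exact pow_eq_zero_iff two_ne_zero |>.1 h
  by_contra hne
  have hEpos : 0 < E r₀ := lt_of_le_of_ne (by positivity) (Ne.symm hne)
  -- two-sided energy bounds on `[r₀, ∞)`
  set m : ℝ := E r₀ * Real.exp (-(c / (k * r₀))) with hm
  set M : ℝ := E r₀ * Real.exp (c / (k * r₀)) with hM
  have hm0 : 0 < m := mul_pos hEpos (Real.exp_pos _)
  have hM0 : 0 < M := mul_pos hEpos (Real.exp_pos _)
  have hbounds : ∀ r, r₀ ≤ r → m ≤ E r ∧ E r ≤ M := fun r hr =>
    energy_bounds ha hk hc hw hw' hode hr₀ hr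
  -- `H = w w'` and its derivative
  set H : ℝ → ℝ := fun s => w s * w' s with hH
  have hHd : ∀ s, a < s → HasDerivAt H (w' s * w' s + w s * w'' s) s := fun s hs =>
    (hw s hs).mul (hw' s hs)
  -- eventually `k² w² ≤ m/4`
  have hsmall : ∀ᶠ s in atTop, k ^ 2 * w s ^ 2 < m / 4 := by
    have ht : Tendsto (fun s => k ^ 2 * w s ^ 2) atTop (𝓝 (k ^ 2 * 0 ^ 2)) :=
      (hlim.pow 2).const_mul _
    rw [zero_pow two_ne_zero, mul_zero] at ht
    exact (tendsto_order.1 ht).2 _ (by positivity)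
  obtain ⟨r₁, hr₁⟩ := (hsmall.and (eventually_ge_atTop r₀)).exists_forall_of_atTop
  have hr₁' : ∀ s, r₁ ≤ s → k ^ 2 * w s ^ 2 < m / 4 ∧ r₀ ≤ s := hr₁
  have hr₀₁ : r₀ ≤ r₁ := (hr₁' r₁ le_rfl).2
  have ha₁ : a < r₁ := hr₀.trans_le hr₀₁
  -- `H' ≥ m/2` on `[r₁, ∞)`, hence `H r ≥ H r₁ + (m/2)(r - r₁)`
  have hH'ge : ∀ s, r₁ ≤ s → m / 2 ≤ w' s * w' s + w s * w'' s := fun s hs => by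
    have hs' : a < s := ha₁.trans_le hs
    obtain ⟨h1, h2⟩ := hr₁' s hs
    have hEs : m ≤ E s := (hbounds s h2).1
    have hcs : 0 ≤ c / s ^ 2 * w s ^ 2 := by positivity
    rw [hode s hs']
    simp only [hE] at hEs
    nlinarith
  have hmonoH : MonotoneOn (fun s => H s - m / 2 * s) (Ici r₁) := by
    refine monotoneOn_of_hasDerivWithinAt_nonneg (convex_Ici r₁)
      (f' := fun s => (w' s * w' s + w s * w'' s) - m / 2 * 1) ?_ ?_ ?_
    · intro s hs
      exact (((hHd s (ha₁.trans_le hs)).sub ((hasDerivAt_id s).const_mul (m / 2))).continuousAt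
        |>.continuousWithinAt)
    · intro s hs
      rw [interior_Ici] at hs
      exact ((hHd s (ha₁.trans hs)).sub ((hasDerivAt_id s).const_mul (m / 2))).hasDerivWithinAt
    · intro s hs
      rw [interior_Ici] at hs
      have := hH'ge s hs.le
      linarith
  have hHge : ∀ s, r₁ ≤ s → H r₁ + m / 2 * (s - r₁) ≤ H s := fun s hs => by
    have := hmonoH (self_mem_Ici (a := r₁)) (mem_Ici.2 hs) hs
    simp only at this
    linarith
  -- `|H| ≤ √M |w| → 0`
  have hHto : Tendsto H atTop (𝓝 0) := by
    have hb : ∀ᶠ s in atTop, ‖H s‖ ≤ Real.sqrt M * |w s| := by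
      filter_upwards [eventually_ge_atTop r₀] with s hs
      have hEs : E s ≤ M := (hbounds s hs).2
      have hw's : w' s ^ 2 ≤ M := by
        have : 0 ≤ k ^ 2 * w s ^ 2 := by positivity
        simp only [hE] at hEs
        linarith
      have habs : |w' s| ≤ Real.sqrt M := by
        rw [← Real.sqrt_sq_eq_abs]
        exact Real.sqrt_le_sqrt hw's
      rw [Real.norm_eq_abs, hH]
      simp only [abs_mul]
      calc |w s| * |w' s| ≤ |w s| * Real.sqrt M :=
            mul_le_mul_of_nonneg_left habs (abs_nonneg _)
        _ = Real.sqrt M * |w s| := mul_comm _ _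
    have ht : Tendsto (fun s => Real.sqrt M * |w s|) atTop (𝓝 0) := by
      have := (continuous_abs.tendsto 0).comp hlim
      rw [abs_zero] at this
      simpa using this.const_mul (Real.sqrt M)
    exact squeeze_zero_norm' hb ht
  -- contradiction: `H` is eventually `< 1` but grows linearly
  obtain ⟨r₂, hr₂⟩ := ((tendsto_order.1 hHto).2 1 one_pos).exists_forall_of_atTop
  set r : ℝ := max (max r₁ r₂) (r₁ + 2 * (1 + |H r₁|) / m) with hr_def
  have hr1 : r₁ ≤ r := (le_max_left _ _).trans (le_max_left _ _)
  have hr2 : r₂ ≤ r := (le_max_right _ _).trans (le_max_left _ _)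
  have hr3 : r₁ + 2 * (1 + |H r₁|) / m ≤ r := le_max_right _ _
  have hlt : H r < 1 := hr₂ r hr2
  have hge := hHge r hr1
  have hkey : m / 2 * (2 * (1 + |H r₁|) / m) = 1 + |H r₁| := by field_simp
  have : 1 + |H r₁| ≤ m / 2 * (r - r₁) := by
    rw [← hkey]
    exact mul_le_mul_of_nonneg_left (by linarith) (by positivity)
  have habs : -|H r₁| ≤ H r₁ := neg_abs_le _
  linarith

end Rellich

end Literature.Analysis.PDE

end
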